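import Mathlib
import HarnessLib
import Summits.Ventures.LatticeQCDFlow.Scaling.LogNormalLimitBridge
import Summits.Ventures.LatticeQCDFlow.Scaling.MartingaleLogWeightCLT

/-!
# LatticeQCDFlow / Scaling — LOG-NORMAL UNIVERSALITY FOR MARTINGALE LOG-WEIGHTS: the IMH acceptance
# of any exact flow sampler with small likelihood-ratio increments of quadratic variation `→ s`
# converges to `erfc(√s/2)` — autoregressive (site-by-site) flows included

HONEST FRAMING: exact (Metropolis-corrected) sampling algorithms for lattice gauge theory;
figures of merit are autocorrelation/cost numbers at stated couplings and volumes; no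
continuum-physics claim.

Venture `LatticeQCDFlow` (cell pub-lqcd), topic `Scaling`; FANOUT row 3 (`s0-u1-a`, S0-B
implementation A, GEN-19).  NEW WORK of the cell (assembly of row 3's martingale log-weight CLT
`Scaling/MartingaleLogWeightCLT` — `Σℓ ⇒ N(−s/2, s)`, `E e^{L} = 1` — with the bridge
`Scaling/LogNormalLimitBridge`); NO definition is introduced; nothing is cited.

## The statement

Arrays `ℓ_{n,t}` (`t < k_n`) of log-weight increments on one probability space with the
likelihood-ratio martingale property `E[F(ℓ_{n,0..t−1})(e^{ℓ_{n,t}} − 1)] = 0` (bounded measurable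
`F`), `|ℓ_{n,t}| ≤ c_n → 0` and `Σ_t ℓ_{n,t}² → s` in probability:
**`martingale_meanAccept_tendsto`** — the equilibrium IMH acceptance over two independent draws,
`∫∫ min(e^{L_n(ω)}, e^{L_n(ω′)}) dP dP`, converges to `∫∫ min(e^x, e^y) dN(−s/2, s)²`, `= erfc(√s/2)`
(**`martingale_meanAccept_tendsto_erfc`**).  So the scorers' log-normal law is universal far beyond
factorised flows: `O(1)` acceptance at `k` sites needs per-site conditional mismatch `O(k^{−1/2})`
in root-mean-square.

NOT CLAIMED: the kernel-level verification of the martingale property for a concrete architecture;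
unbounded increments; rates; any value at the cell's `(β, L)`; nothing re-scored.
-/

noncomputable section

namespace Summit.Ventures.LatticeQCDFlow.Theory2

open MeasureTheory ProbabilityTheory Filter Finset Real Set
open scoped Topology NNReal
open Literature.Probability.Distributions.PseudoMarginalNoise

section MartingaleAcceptance

variable {Ω : Type*} [MeasurableSpace Ω] {P : Measure Ω} [IsProbabilityMeasure P]
  {ℓ : ℕ → ℕ → Ω → ℝ} {k : ℕ → ℕ}

/-- **MARTINGALE LOG-NORMAL UNIVERSALITY OF THE ACCEPTANCE.**  Under the hypotheses of
`martingale_rowSum_tendstoInDistribution`, the equilibrium IMH acceptance over two independent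
draws of the log-weight converges to the log-normal law `∫∫ min(e^x, e^y) dN(−s/2, s)²`. [ours] -/
theorem martingale_meanAccept_tendsto (hℓm : ∀ n t, Measurable (ℓ n t)) {c : ℕ → ℝ}
    (hc : ∀ n t ω, |ℓ n t ω| ≤ c n) (hc0 : Tendsto c atTop (𝓝 0))
    (horth : ∀ (n t : ℕ) (F : (Fin t → ℝ) → ℝ) (K' : ℝ), Measurable F → (∀ w, |F w| ≤ K') →
      ∫ ω, F (fun i => ℓ n i ω) * (Real.exp (ℓ n t ω) - 1) ∂P = 0)
    {s : ℝ} (hs : 0 ≤ s)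
    (hQV : TendstoInMeasure P (fun n ω => ∑ t ∈ Finset.range (k n), ℓ n t ω ^ 2) atTop (fun _ => s)) :
    Tendsto (fun n => ∫ ω, ∫ ω', min (Real.exp (∑ t ∈ Finset.range (k n), ℓ n t ω))
        (Real.exp (∑ t ∈ Finset.range (k n), ℓ n t ω')) ∂P ∂P) atTop
      (𝓝 (∫ x, ∫ y, min (Real.exp x) (Real.exp y) ∂(noiseLaw s.toNNReal) ∂(noiseLaw s.toNNReal))) := by
  -- a Gaussian `Y ∼ N(−s/2, s)` on `(ℝ, noiseLaw s)`
  have hsR : ((s.toNNReal : ℝ≥0) : ℝ) = s := Real.coe_toNNReal s hs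
  have hY : HasLaw (id : ℝ → ℝ) (gaussianReal (-(s / 2)) s.toNNReal) (noiseLaw s.toNNReal) := by
    refine ⟨aemeasurable_id, ?_⟩
    rw [Measure.map_id, noiseLaw, hsR]
  haveI : IsProbabilityMeasure (noiseLaw s.toNNReal) := by rw [noiseLaw]; infer_instance
  have hL := martingale_rowSum_tendstoInDistribution (P' := noiseLaw s.toNNReal) hℓm hc hc0 horth hs hQV hY
  have hYn : HasLaw (id : ℝ → ℝ) (noiseLaw s.toNNReal) (noiseLaw s.toNNReal) := ⟨aemeasurable_id, Measure.map_id⟩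
  refine meanAccept_tendsto_of_tendstoInDistribution (Ω := fun _ => Ω) (P := fun _ => P)
    (fun n => Finset.measurable_sum _ fun t _ => hℓm n t) (s.toNNReal) hYn hL (B := 1) le_rfl
    (fun n => ?_) (fun n => (martingale_integral_exp_rowSum_eq_one hℓm hc horth n (k n)).le)
  -- integrability of the bounded weight
  refine Integrable.of_mem_Icc 0 (Real.exp (k n * c n)) (by fun_prop) (ae_of_all _ fun ω => ⟨(Real.exp_pos _).le, ?_⟩)
  rw [Real.exp_le_exp]
  calc ∑ t ∈ Finset.range (k n), ℓ n t ω ≤ ∑ _t ∈ Finset.range (k n), c n :=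
        Finset.sum_le_sum fun t _ => (le_abs_self _).trans (hc n t ω)
    _ = k n * c n := by simp

/-- **`= erfc(√s/2)`** for `s ≠ 0`. [ours] -/
theorem martingale_meanAccept_tendsto_erfc (hℓm : ∀ n t, Measurable (ℓ n t)) {c : ℕ → ℝ}
    (hc : ∀ n t ω, |ℓ n t ω| ≤ c n) (hc0 : Tendsto c atTop (𝓝 0))
    (horth : ∀ (n t : ℕ) (F : (Fin t → ℝ) → ℝ) (K' : ℝ), Measurable F → (∀ w, |F w| ≤ K') →
      ∫ ω, F (fun i => ℓ n i ω) * (Real.exp (ℓ n t ω) - 1) ∂P = 0)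
    {s : ℝ} (hs : 0 < s)
    (hQV : TendstoInMeasure P (fun n ω => ∑ t ∈ Finset.range (k n), ℓ n t ω ^ 2) atTop (fun _ => s)) :
    Tendsto (fun n => ∫ ω, ∫ ω', min (Real.exp (∑ t ∈ Finset.range (k n), ℓ n t ω))
        (Real.exp (∑ t ∈ Finset.range (k n), ℓ n t ω')) ∂P ∂P) atTop
      (𝓝 (2 / Real.sqrt Real.pi * ∫ u in Ioi (Real.sqrt s / 2), Real.exp (-u ^ 2))) := by
  have hsne : s.toNNReal ≠ 0 := fun h => absurd (Real.toNNReal_eq_zero.1 h) (not_le.2 hs)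
  have h := martingale_meanAccept_tendsto (k := k) hℓm hc hc0 horth hs.le hQV
  rw [Scoring.imh_lognormal_accRate_eq_erfc hsne, Real.coe_toNNReal s hs.le] at h
  exact h

/-- **`→ 1`** when the quadratic variation vanishes (`s = 0`: asymptotically perfect proposals). [ours] -/
theorem martingale_meanAccept_tendsto_one (hℓm : ∀ n t, Measurable (ℓ n t)) {c : ℕ → ℝ}
    (hc : ∀ n t ω, |ℓ n t ω| ≤ c n) (hc0 : Tendsto c atTop (𝓝 0))
    (horth : ∀ (n t : ℕ) (F : (Fin t → ℝ) → ℝ) (K' : ℝ), Measurable F → (∀ w, |F w| ≤ K') →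
      ∫ ω, F (fun i => ℓ n i ω) * (Real.exp (ℓ n t ω) - 1) ∂P = 0)
    (hQV : TendstoInMeasure P (fun n ω => ∑ t ∈ Finset.range (k n), ℓ n t ω ^ 2) atTop (fun _ => (0 : ℝ))) :
    Tendsto (fun n => ∫ ω, ∫ ω', min (Real.exp (∑ t ∈ Finset.range (k n), ℓ n t ω))
        (Real.exp (∑ t ∈ Finset.range (k n), ℓ n t ω')) ∂P ∂P) atTop (𝓝 1) := by
  have h := martingale_meanAccept_tendsto (k := k) hℓm hc hc0 horth le_rfl hQV
  have e : ∫ x, ∫ y, min (Real.exp x) (Real.exp y) ∂(noiseLaw (0 : ℝ).toNNReal) ∂(noiseLaw (0 : ℝ).toNNReal)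
      = 1 := by
    simp [noiseLaw]
  rw [e] at h
  exact h

end MartingaleAcceptance

end Summit.Ventures.LatticeQCDFlow.Theory2

end
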